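import Summits.ABC.ABC.Theorems.IneffectiveSubspaceDepthCountedABCStubCalibration
import Summits.ABC.ABC.Theorems.IneffectiveSubspaceDepthCountedABCStubBase

/-!
# Stub `stub_cellZeroOfUniformQuarticThue` of line `Sketch` — crux `IneffectiveSubspace.DepthCountedABC` (stmt-ABC-14938)

THE WEAKEST OPEN FACE OF CELL 0 (lead c19).  On the 5-free cell `#{p : v_p(abc) ≥ 5} = 0` the crux asks for
`c < C·rad(abc)^(1+ε)`; what holds for free is exponent `2` (`c² ≤ 2·rad(abc)⁴`, `stub_calibration`).  This
certificate pins down what the FIRST improvement below `2` costs: it follows from a UNIFORM BINOMIAL QUARTIC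
THUE statement — for some `η > 0` the positive coprime solutions of `a + u·Y⁴ = v·Z⁴` with `a·u·v ≤ Z^η` have
bounded `Z` (a bound, polynomial and uniform in the coefficients `(a, u, v)`, on the smallest solution of the
binomial Thue equation `vZ⁴ − uY⁴ = a`; equivalently a saving `Z^(−4+κ)` over Liouville for `(u/v)^(1/4)`,
uniform over heights `≤ Z^η`).  Mechanism (all elementary): order the triple `a ≤ b`; if `c ≥ rad(abc)^(2−δ)`
then `a·c² ≤ 2abc ≤ 2rad⁴` makes `a` small, and writing a 5-free `n` as `n = u·Y⁴` (`Y = ∏_{v_p = 4} p`,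
`u = ∏_{v_p ≤ 3} p^{v_p}`) with defect `E(n) = ∏_{v_p ≤ 3} p^(4−v_p)` one has `E(n)·n = rad(n)⁴` and `u ≤ E(n)³`,
so `E(b)E(c)·c² ≤ 2·(rad b·rad c)⁴ ≤ 2rad⁴` makes `u, v` small: `a·u·v·c⁸ ≤ 16·rad¹⁶` and `c⁷ ≤ 8·rad¹²·Z⁴`.
With `δ = min(η,1)/64` either `a·u·v ≤ Z^η` (then `Z ≤ B` and `rad ≤ 8B⁴`) or `Z^η < a·u·v ≤ 16·rad^(8δ)` while
`Z⁴ ≥ rad/8` (then `rad^(η/8) < 16·8^(η/4)`); either way `rad`, hence `c < 2rad²`, is bounded on the exceptional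
triples.  In print the hypothesis is OPEN: Thue–Siegel / hypergeometric methods bound the NUMBER of large
solutions per coefficient class (Siegel 1937; Evertse 1982; Bennett 2001), Baker-type bounds give the size only as
`exp(poly(a,u,v))`, effective Padé measures need `v/u` multiplicatively close to `1`.

Sources: skeleton `Cruxes/DepthCountedABC/Lines/Sketch.lean` (lead c19, stub `stub_cellZeroOfUniformQuarticThue`);
lemmas of `IneffectiveSubspaceDepthCountedABCStubCalibration` / `…StubBase` (5-freeness bookkeeping).  Mathlib only
otherwise.  Deliberately NOT here: the converse (exponent `2−δ` on cell 0 ⟹ the Thue statement on the squarefree-coprime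
locus), and anything at exponent `1+ε`.
-/

-- `Summit.<Summit>.<Problem>` is the mandated summit-side namespace (CONVENTIONS §2); for the
-- single-conjunct summit `ABC` the two coincide, so the duplicate `ABC.ABC` is deliberate.
set_option linter.dupNamespace false

namespace Summit.ABC.ABC.Theorems.DepthCountedABC

open scoped BigOperators

section QuarticThue
open UniqueFactorizationMonoid (radical)
open Literature.NumberTheory.DiophantineGeometry (IsABCTriple rad rad_def)

/-- Splitting of `n ≠ 0` into its non-quartic part and the fourth power of its quartic support:
`n = (∏_{v_p(n) ≠ 4} p^{v_p(n)}) · (∏_{v_p(n) = 4} p)⁴`. [folklore] -/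
theorem quarticThue_split {n : ℕ} (hn : n ≠ 0) :
    n = (∏ p ∈ n.primeFactors.filter (fun p => ¬ n.factorization p = 4), p ^ n.factorization p) *
        (∏ p ∈ n.primeFactors.filter (fun p => n.factorization p = 4), p) ^ 4 := by
  have hself : ∏ p ∈ n.primeFactors, p ^ n.factorization p = n := by
    conv_rhs => rw [← Nat.prod_factorization_pow_eq_self hn]
    rw [Finsupp.prod, Nat.support_factorization]
  have hsplit :
      (∏ p ∈ n.primeFactors.filter (fun p => n.factorization p = 4), p ^ n.factorization p) *
        (∏ p ∈ n.primeFactors.filter (fun p => ¬ n.factorization p = 4), p ^ n.factorization p) =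
      ∏ p ∈ n.primeFactors, p ^ n.factorization p :=
    Finset.prod_filter_mul_prod_filter_not n.primeFactors (fun p => n.factorization p = 4)
      (fun p => p ^ n.factorization p)
  have h4 : (∏ p ∈ n.primeFactors.filter (fun p => n.factorization p = 4), p ^ n.factorization p) =
      (∏ p ∈ n.primeFactors.filter (fun p => n.factorization p = 4), p) ^ 4 := by
    rw [← Finset.prod_pow]
    refine Finset.prod_congr rfl (fun p hp => ?_)
    rw [(Finset.mem_filter.mp hp).2]
  calc n = ∏ p ∈ n.primeFactors, p ^ n.factorization p := hself.symm
    _ = _ := by rw [← hsplit, h4, mul_comm]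

/-- On a 5-free `n` the non-quartic part is at most the cube of the defect
`E(n) = ∏_{v_p(n) ≠ 4} p^(4 − v_p(n))` (prime by prime `p^v ≤ p^(3(4−v))` for `v ≤ 3`). [folklore] -/
theorem quarticThue_low_le_defect_cube {n : ℕ} (h4 : ∀ p ∈ n.primeFactors, n.factorization p ≤ 4) :
    (∏ p ∈ n.primeFactors.filter (fun p => ¬ n.factorization p = 4), p ^ n.factorization p) ≤
      (∏ p ∈ n.primeFactors.filter (fun p => ¬ n.factorization p = 4), p ^ (4 - n.factorization p)) ^ 3 := by
  rw [← Finset.prod_pow]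
  apply Finset.prod_le_prod'
  intro p hp
  obtain ⟨hp, hne⟩ := Finset.mem_filter.mp hp
  rw [← pow_mul]
  apply Nat.pow_le_pow_right (Nat.pos_of_mem_primeFactors hp)
  have := h4 p hp
  omega

/-- On a 5-free `n ≠ 0`: defect times `n` is the fourth power of the radical, `E(n)·n = rad(n)⁴`. [folklore] -/
theorem quarticThue_defect_mul {n : ℕ} (hn : n ≠ 0) (h4 : ∀ p ∈ n.primeFactors, n.factorization p ≤ 4) :
    (∏ p ∈ n.primeFactors.filter (fun p => ¬ n.factorization p = 4), p ^ (4 - n.factorization p)) * n =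
      (radical n) ^ 4 := by
  set S := n.primeFactors.filter (fun p => ¬ n.factorization p = 4) with hS
  set T := n.primeFactors.filter (fun p => n.factorization p = 4) with hT
  have hsplit : n = (∏ p ∈ S, p ^ n.factorization p) * (∏ p ∈ T, p) ^ 4 := quarticThue_split hn
  have hSS : (∏ p ∈ S, p ^ (4 - n.factorization p)) * (∏ p ∈ S, p ^ n.factorization p) =
      ∏ p ∈ S, p ^ 4 := by
    rw [← Finset.prod_mul_distrib]
    refine Finset.prod_congr rfl (fun p hp => ?_)
    rw [← pow_add, Nat.sub_add_cancel (h4 p (Finset.mem_filter.mp hp).1)]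
  have hTT : (∏ p ∈ T, p) ^ 4 = ∏ p ∈ T, p ^ 4 := (Finset.prod_pow T 4 fun p => p).symm
  have hall : (∏ p ∈ T, p ^ 4) * (∏ p ∈ S, p ^ 4) = ∏ p ∈ n.primeFactors, p ^ 4 :=
    Finset.prod_filter_mul_prod_filter_not n.primeFactors (fun p => n.factorization p = 4) (fun p => p ^ 4)
  calc (∏ p ∈ S, p ^ (4 - n.factorization p)) * n
        = (∏ p ∈ S, p ^ (4 - n.factorization p)) * ((∏ p ∈ S, p ^ n.factorization p) * (∏ p ∈ T, p) ^ 4) :=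
          congrArg (fun t => (∏ p ∈ S, p ^ (4 - n.factorization p)) * t) hsplit
    _ = ((∏ p ∈ S, p ^ (4 - n.factorization p)) * (∏ p ∈ S, p ^ n.factorization p)) *
            (∏ p ∈ T, p) ^ 4 := by ring
    _ = (∏ p ∈ T, p ^ 4) * (∏ p ∈ S, p ^ 4) := by rw [hSS, hTT, mul_comm]
    _ = (∏ p ∈ n.primeFactors, p) ^ 4 := by rw [hall, Finset.prod_pow]
    _ = (radical n) ^ 4 := by rw [Nat.radical_eq_prod_primeFactors]

/-- The elementary bookkeeping of the reduction, for a 5-free abc triple ordered `a ≤ b`: `b = uY⁴`, `c = vZ⁴`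
(non-quartic parts times fourth powers of the quartic supports) with
`a·u·v·c⁸ ≤ 16·rad(abc)¹⁶`, `c⁷ ≤ 8·rad(abc)¹²·Z⁴` and `c < 2·rad(abc)²`. [folklore] -/
theorem quarticThue_natBounds {a b c : ℕ} (h : IsABCTriple a b c) (hab : a ≤ b)
    (h4 : ∀ p ∈ (a * b * c).primeFactors, (a * b * c).factorization p ≤ 4) :
    ∃ u v Y Z : ℕ, b = u * Y ^ 4 ∧ c = v * Z ^ 4 ∧ 0 < u ∧ 0 < v ∧ 0 < Y ∧ 0 < Z ∧
      a * u * v * c ^ 8 ≤ 16 * (rad a b c) ^ 16 ∧ c ^ 7 ≤ 8 * (rad a b c) ^ 12 * Z ^ 4 ∧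
      c < 2 * (rad a b c) ^ 2 := by
  obtain ⟨ha, hb, hsum, hcop⟩ := h
  have hc : 0 < c := by omega
  have hne : a * b * c ≠ 0 := by positivity
  have hb0 : b ≠ 0 := hb.ne'
  have hc0 : c ≠ 0 := hc.ne'
  have hbc : Nat.Coprime b c := by
    rw [← hsum, add_comm, Nat.coprime_self_add_right]; exact hcop.symm
  have hdb : b ∣ a * b * c := dvd_mul_of_dvd_left (dvd_mul_left b a) c
  have hdc : c ∣ a * b * c := dvd_mul_left c (a * b)
  have hb4 : ∀ p ∈ b.primeFactors, b.factorization p ≤ 4 := stubBase_factor_fiveFree hne hdb h4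
  have hc4 : ∀ p ∈ c.primeFactors, c.factorization p ≤ 4 := stubBase_factor_fiveFree hne hdc h4
  -- the pieces
  set u := ∏ p ∈ b.primeFactors.filter (fun p => ¬ b.factorization p = 4), p ^ b.factorization p with hu
  set Y := ∏ p ∈ b.primeFactors.filter (fun p => b.factorization p = 4), p with hY
  set Eb := ∏ p ∈ b.primeFactors.filter (fun p => ¬ b.factorization p = 4), p ^ (4 - b.factorization p)
    with hEb
  set v := ∏ p ∈ c.primeFactors.filter (fun p => ¬ c.factorization p = 4), p ^ c.factorization p with hv
  set Z := ∏ p ∈ c.primeFactors.filter (fun p => c.factorization p = 4), p with hZ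
  set Ec := ∏ p ∈ c.primeFactors.filter (fun p => ¬ c.factorization p = 4), p ^ (4 - c.factorization p)
    with hEc
  set R := rad a b c with hR
  have hRdef : R = radical (a * b * c) := rad_def a b c
  have hbsplit : b = u * Y ^ 4 := quarticThue_split hb0
  have hcsplit : c = v * Z ^ 4 := quarticThue_split hc0
  have hule : u ≤ Eb ^ 3 := quarticThue_low_le_defect_cube hb4
  have hvle : v ≤ Ec ^ 3 := quarticThue_low_le_defect_cube hc4
  have hEbb : Eb * b = (radical b) ^ 4 := quarticThue_defect_mul hb0 hb4
  have hEcc : Ec * c = (radical c) ^ 4 := quarticThue_defect_mul hc0 hc4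
  have hupos : 0 < u := Finset.prod_pos fun p hp =>
    pow_pos (Nat.pos_of_mem_primeFactors (Finset.mem_filter.mp hp).1) _
  have hvpos : 0 < v := Finset.prod_pos fun p hp =>
    pow_pos (Nat.pos_of_mem_primeFactors (Finset.mem_filter.mp hp).1) _
  have hYpos : 0 < Y := Finset.prod_pos fun p hp => Nat.pos_of_mem_primeFactors (Finset.mem_filter.mp hp).1
  have hZpos : 0 < Z := Finset.prod_pos fun p hp => Nat.pos_of_mem_primeFactors (Finset.mem_filter.mp hp).1
  have hEbpos : 0 < Eb := Finset.prod_pos fun p hp =>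
    pow_pos (Nat.pos_of_mem_primeFactors (Finset.mem_filter.mp hp).1) _
  -- radicals
  have hradbc : radical b * radical c ≤ R := by
    rw [hRdef, ← UniqueFactorizationMonoid.radical_mul (Nat.coprime_iff_isRelPrime.mp hbc)]
    exact Nat.le_of_dvd (Nat.radical_pos _)
      (UniqueFactorizationMonoid.radical_dvd_radical ⟨a, by ring⟩ hne)
  have habc : a * b * c ≤ R ^ 4 := by
    rw [hRdef]; exact calibration_le_radical_pow_of_factorization_le hne h4
  have hc2b : c ≤ 2 * b := by omega
  -- F1, F2
  have hF1 : a * c ^ 2 ≤ 2 * R ^ 4 :=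
    calc a * c ^ 2 = a * c * c := by ring
      _ ≤ a * c * (2 * b) := Nat.mul_le_mul_left _ hc2b
      _ = 2 * (a * b * c) := by ring
      _ ≤ 2 * R ^ 4 := Nat.mul_le_mul_left 2 habc
  have hF2 : Eb * Ec * c ^ 2 ≤ 2 * R ^ 4 :=
    calc Eb * Ec * c ^ 2 = Eb * Ec * c * c := by ring
      _ ≤ Eb * Ec * c * (2 * b) := Nat.mul_le_mul_left _ hc2b
      _ = 2 * ((Eb * b) * (Ec * c)) := by ring
      _ = 2 * (radical b * radical c) ^ 4 := by rw [hEbb, hEcc]; ring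
      _ ≤ 2 * R ^ 4 := Nat.mul_le_mul_left 2 (Nat.pow_le_pow_left hradbc 4)
  refine ⟨u, v, Y, Z, hbsplit, hcsplit, hupos, hvpos, hYpos, hZpos, ?_, ?_, ?_⟩
  · -- F5 : a u v c⁸ ≤ (a c²)·(Eb Ec c²)³ ≤ 2R⁴ · 8R¹²
    calc a * u * v * c ^ 8 ≤ a * Eb ^ 3 * Ec ^ 3 * c ^ 8 := by gcongr
      _ = (a * c ^ 2) * (Eb * Ec * c ^ 2) ^ 3 := by ring
      _ ≤ (2 * R ^ 4) * (2 * R ^ 4) ^ 3 := Nat.mul_le_mul hF1 (Nat.pow_le_pow_left hF2 3)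
      _ = 16 * R ^ 16 := by ring
  · -- F6 : c⁷ = (v c⁶)·Z⁴ and v c⁶ ≤ (Ec c²)³ ≤ (Eb Ec c²)³ ≤ 8R¹²
    have hvc : v * c ^ 6 ≤ 8 * R ^ 12 :=
      calc v * c ^ 6 ≤ Ec ^ 3 * c ^ 6 := Nat.mul_le_mul_right _ hvle
        _ = (Ec * c ^ 2) ^ 3 := by ring
        _ ≤ (Eb * Ec * c ^ 2) ^ 3 := by
            apply Nat.pow_le_pow_left
            calc Ec * c ^ 2 = 1 * (Ec * c ^ 2) := (one_mul _).symm
              _ ≤ Eb * (Ec * c ^ 2) := Nat.mul_le_mul_right _ hEbpos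
              _ = Eb * Ec * c ^ 2 := by ring
        _ ≤ (2 * R ^ 4) ^ 3 := Nat.pow_le_pow_left hF2 3
        _ = 8 * R ^ 12 := by ring
    calc c ^ 7 = c ^ 6 * c := by ring
      _ = c ^ 6 * (v * Z ^ 4) := by rw [← hcsplit]
      _ = (v * c ^ 6) * Z ^ 4 := by ring
      _ ≤ 8 * R ^ 12 * Z ^ 4 := Nat.mul_le_mul_right _ hvc
  · -- c < 2R² from c² ≤ 2abc ≤ 2R⁴ < (2R²)²
    have hR1 : 1 ≤ R := by rw [hRdef]; exact Nat.radical_pos _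
    have hc2 : c ^ 2 ≤ 2 * R ^ 4 :=
      (calibration_sq_le_two_mul_prod ⟨ha, hb, hsum, hcop⟩).trans (Nat.mul_le_mul_left 2 habc)
    by_contra hlt
    push Not at hlt
    have h' : (2 * R ^ 2) ^ 2 ≤ c ^ 2 := Nat.pow_le_pow_left hlt 2
    have hR4 : 0 < R ^ 4 := by positivity
    nlinarith

end QuarticThue

open UniqueFactorizationMonoid (radical) in
open Literature.NumberTheory.DiophantineGeometry (IsABCTriple rad rad_def) in
/-- **Stub `stub_cellZeroOfUniformQuarticThue` (the weakest open face of cell 0) of line `Sketch`, crux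
`DepthCountedABC` (stmt-ABC-14938):** if for some `η > 0` the positive coprime solutions of the binomial
quartic Thue equation `a + u·Y⁴ = v·Z⁴` with `a·u·v ≤ Z^η` have bounded `Z` (uniform binomial quartic
Thue), then abc holds on the 5-free cell `#{p : v_p(abc) ≥ 5} = 0` with SOME exponent `2 − δ < 2`
(`δ = min(η,1)/64` works): `c < C·rad(abc)^(2−δ)`. [folklore reduction; hypothesis open] -/
theorem stub_cellZeroOfUniformQuarticThue : ∀ η : ℝ, 0 < η →
    (∃ B : ℕ, ∀ a u v Y Z : ℕ, 0 < a → 0 < u → 0 < v → 0 < Y → 0 < Z →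
        a + u * Y ^ 4 = v * Z ^ 4 → Nat.Coprime (u * Y ^ 4) (v * Z ^ 4) →
        ((a * u * v : ℕ) : ℝ) ≤ (Z : ℝ) ^ η → Z ≤ B) →
    ∃ δ : ℝ, 0 < δ ∧ ∃ C : ℝ, 0 < C ∧ ∀ a b c : ℕ,
      Literature.NumberTheory.DiophantineGeometry.IsABCTriple a b c →
      ((a * b * c).primeFactors.filter (fun p => 5 ≤ (a * b * c).factorization p)).card = 0 →
      (c : ℝ) < C * ((Literature.NumberTheory.DiophantineGeometry.rad a b c : ℕ) : ℝ) ^ (2 - δ) := by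
  intro η hη hT
  obtain ⟨B, hB⟩ := hT
  -- parameters
  set η' : ℝ := min η 1 with hη'
  have hη'pos : 0 < η' := lt_min hη one_pos
  have hη'le : η' ≤ η := min_le_left _ _
  have hη'le1 : η' ≤ 1 := min_le_right _ _
  set δ : ℝ := η' / 64 with hδ
  have hδpos : 0 < δ := by positivity
  have hδle : δ ≤ 1 / 64 := by rw [hδ]; linarith
  set K : ℝ := 16 * (8 : ℝ) ^ (η' / 4) with hK
  have hKpos : 0 < K := by positivity
  set R₀ : ℝ := max (8 * (B : ℝ) ^ 4) (K ^ (8 / η')) + 1 with hR₀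
  have hR₀pos : 0 < R₀ := by
    have : (0 : ℝ) ≤ max (8 * (B : ℝ) ^ 4) (K ^ (8 / η')) :=
      le_trans (by positivity) (le_max_left _ _)
    linarith
  refine ⟨δ, hδpos, 2 * R₀ ^ 2 + 1, by positivity, ?_⟩
  intro a b c habc h0
  -- WLOG `a ≤ b` (all three data are symmetric in `a, b`)
  wlog hab : a ≤ b generalizing a b with H
  · have hsw : IsABCTriple b a c :=
      ⟨habc.2.1, habc.1, by rw [add_comm]; exact habc.2.2.1, habc.2.2.2.symm⟩
    have hprod : b * a * c = a * b * c := by ring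
    have h0' : ((b * a * c).primeFactors.filter (fun p => 5 ≤ (b * a * c).factorization p)).card = 0 := by
      rw [hprod]; exact h0
    have := H b a hsw h0' (le_of_not_ge hab)
    rwa [rad_def, hprod, ← rad_def] at this
  -- the ordered case
  have h4 : ∀ p ∈ (a * b * c).primeFactors, (a * b * c).factorization p ≤ 4 :=
    calibration_fiveFree_of_card_eq_zero h0
  obtain ⟨u, v, Y, Z, hbuY, hcvZ, hu, hv, hY, hZ, hF5, hF6, hc2⟩ := quarticThue_natBounds habc hab h4
  obtain ⟨ha, hb, hsum, hcop⟩ := habc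
  set R := rad a b c with hR
  have hR1nat : 1 ≤ R := by rw [hR, rad_def]; exact Nat.radical_pos _
  have hx1 : (1 : ℝ) ≤ (R : ℝ) := by exact_mod_cast hR1nat
  have hx0 : (0 : ℝ) < (R : ℝ) := by linarith
  have hδ2 : (0 : ℝ) ≤ 2 - δ := by linarith
  have hpow1 : (1 : ℝ) ≤ (R : ℝ) ^ (2 - δ) := Real.one_le_rpow hx1 hδ2
  have hc2R : (c : ℝ) < 2 * (R : ℝ) ^ 2 := by exact_mod_cast hc2
  by_cases hexc : (R : ℝ) ^ (2 - δ) ≤ (c : ℝ)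
  · -- exceptional triple: `rad` is bounded by `R₀`
    have hcpos : (0 : ℝ) < (c : ℝ) := by exact_mod_cast (show 0 < c by omega)
    have hZ1 : (1 : ℝ) ≤ (Z : ℝ) := by exact_mod_cast hZ
    have hZ0 : (0 : ℝ) ≤ (Z : ℝ) := by positivity
    -- real forms of F5, F6
    have hF5R : ((a * u * v : ℕ) : ℝ) * (c : ℝ) ^ 8 ≤ 16 * (R : ℝ) ^ 16 := by exact_mod_cast hF5
    have hF6R : (c : ℝ) ^ 7 ≤ 8 * (R : ℝ) ^ 12 * (Z : ℝ) ^ 4 := by exact_mod_cast hF6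
    -- powers of the exceptional inequality
    have hexc7 : (R : ℝ) ^ ((2 - δ) * 7) ≤ (c : ℝ) ^ 7 := by
      rw [Real.rpow_mul hx0.le, Real.rpow_ofNat]
      exact pow_le_pow_left₀ (Real.rpow_nonneg hx0.le _) hexc 7
    have hexc8 : (R : ℝ) ^ ((2 - δ) * 8) ≤ (c : ℝ) ^ 8 := by
      rw [Real.rpow_mul hx0.le, Real.rpow_ofNat]
      exact pow_le_pow_left₀ (Real.rpow_nonneg hx0.le _) hexc 8
    have hxR₀ : (R : ℝ) < R₀ := by
      by_cases hA : ((a * u * v : ℕ) : ℝ) ≤ (Z : ℝ) ^ η'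
      · -- Case A: the Thue hypothesis bounds `Z`, and `c⁷ ≤ 8R¹²Z⁴` with `c ≥ R^(2−δ)` bounds `R`
        have hZη : ((a * u * v : ℕ) : ℝ) ≤ (Z : ℝ) ^ η :=
          hA.trans (Real.rpow_le_rpow_of_exponent_le hZ1 hη'le)
        have heq : a + u * Y ^ 4 = v * Z ^ 4 := by rw [← hbuY, ← hcvZ, hsum]
        have hcopr : Nat.Coprime (u * Y ^ 4) (v * Z ^ 4) := by
          rw [← hbuY, ← hcvZ, ← hsum, add_comm, Nat.coprime_self_add_right]; exact hcop.symm
        have hZB : Z ≤ B := hB a u v Y Z ha hu hv hY hZ heq hcopr hZη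
        have hZBR : (Z : ℝ) ^ 4 ≤ (B : ℝ) ^ 4 := by
          exact_mod_cast Nat.pow_le_pow_left hZB 4
        have h13 : (R : ℝ) ^ (13 : ℝ) ≤ (R : ℝ) ^ ((2 - δ) * 7) :=
          Real.rpow_le_rpow_of_exponent_le hx1 (by linarith)
        have hchain : (R : ℝ) ^ (13 : ℕ) ≤ 8 * (B : ℝ) ^ 4 * (R : ℝ) ^ (12 : ℕ) := by
          have h1 : (R : ℝ) ^ (13 : ℕ) ≤ (c : ℝ) ^ 7 := by
            rw [← Real.rpow_natCast]
            push_cast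
            exact h13.trans hexc7
          calc (R : ℝ) ^ (13 : ℕ) ≤ (c : ℝ) ^ 7 := h1
            _ ≤ 8 * (R : ℝ) ^ 12 * (Z : ℝ) ^ 4 := hF6R
            _ ≤ 8 * (R : ℝ) ^ 12 * (B : ℝ) ^ 4 := by gcongr
            _ = 8 * (B : ℝ) ^ 4 * (R : ℝ) ^ (12 : ℕ) := by ring
        have hx12 : (0 : ℝ) < (R : ℝ) ^ (12 : ℕ) := by positivity
        have hxle : (R : ℝ) ≤ 8 * (B : ℝ) ^ 4 := by
          have : (R : ℝ) * (R : ℝ) ^ (12 : ℕ) ≤ (8 * (B : ℝ) ^ 4) * (R : ℝ) ^ (12 : ℕ) := by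
            calc (R : ℝ) * (R : ℝ) ^ (12 : ℕ) = (R : ℝ) ^ (13 : ℕ) := by ring
              _ ≤ _ := hchain
          exact le_of_mul_le_mul_right this hx12
        calc (R : ℝ) ≤ 8 * (B : ℝ) ^ 4 := hxle
          _ ≤ max (8 * (B : ℝ) ^ 4) (K ^ (8 / η')) := le_max_left _ _
          _ < R₀ := by rw [hR₀]; linarith
      · -- Case B: `Z^η' < a·u·v ≤ 16 R^(8δ)` while `Z⁴ ≥ R/8`, so `R^(η'/8) < K`
        push Not at hA
        -- upper bound for `a u v`
        have hc8pos : (0 : ℝ) < (c : ℝ) ^ 8 := by positivity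
        have hauv : ((a * u * v : ℕ) : ℝ) ≤ 16 * (R : ℝ) ^ (8 * δ) := by
          have h1 : ((a * u * v : ℕ) : ℝ) ≤ 16 * (R : ℝ) ^ 16 / (c : ℝ) ^ 8 := by
            rw [le_div_iff₀ hc8pos]; exact hF5R
          have h2 : 16 * (R : ℝ) ^ 16 / (c : ℝ) ^ 8 ≤ 16 * (R : ℝ) ^ 16 / (R : ℝ) ^ ((2 - δ) * 8) :=
            div_le_div_of_nonneg_left (by positivity) (Real.rpow_pos_of_pos hx0 _) hexc8
          have h3 : 16 * (R : ℝ) ^ 16 / (R : ℝ) ^ ((2 - δ) * 8) = 16 * (R : ℝ) ^ (8 * δ) := by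
            have : (R : ℝ) ^ (16 : ℕ) = (R : ℝ) ^ ((2 - δ) * 8) * (R : ℝ) ^ (8 * δ) := by
              rw [← Real.rpow_add hx0]
              have he : (2 - δ) * 8 + 8 * δ = ((16 : ℕ) : ℝ) := by push_cast; ring
              rw [he, Real.rpow_natCast]
            rw [this]
            have hne : (R : ℝ) ^ ((2 - δ) * 8) ≠ 0 := (Real.rpow_pos_of_pos hx0 _).ne'
            field_simp
          linarith [h1, h2, h3.le]
        -- lower bound for `Z ^ 4`
        have hZ4 : (R : ℝ) / 8 ≤ (Z : ℝ) ^ 4 := by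
          have h1 : (R : ℝ) ^ (1 : ℝ) ≤ (R : ℝ) ^ ((2 - δ) * 7 - 12) :=
            Real.rpow_le_rpow_of_exponent_le hx1 (by linarith)
          have h2 : (R : ℝ) ^ ((2 - δ) * 7 - 12) * (R : ℝ) ^ (12 : ℝ) = (R : ℝ) ^ ((2 - δ) * 7) := by
            rw [← Real.rpow_add hx0]; ring_nf
          have h3 : (R : ℝ) * (R : ℝ) ^ (12 : ℕ) ≤ 8 * (R : ℝ) ^ 12 * (Z : ℝ) ^ 4 := by
            calc (R : ℝ) * (R : ℝ) ^ (12 : ℕ) = (R : ℝ) ^ (1 : ℝ) * (R : ℝ) ^ (12 : ℝ) := by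
                  rw [Real.rpow_one, ← Real.rpow_natCast]; norm_num
              _ ≤ (R : ℝ) ^ ((2 - δ) * 7 - 12) * (R : ℝ) ^ (12 : ℝ) := by
                  gcongr
              _ = (R : ℝ) ^ ((2 - δ) * 7) := h2
              _ ≤ (c : ℝ) ^ 7 := hexc7
              _ ≤ 8 * (R : ℝ) ^ 12 * (Z : ℝ) ^ 4 := hF6R
          have hx12 : (0 : ℝ) < (R : ℝ) ^ (12 : ℕ) := by positivity
          have : (R : ℝ) ≤ 8 * (Z : ℝ) ^ 4 := by
            have h4' : (R : ℝ) * (R : ℝ) ^ (12 : ℕ) ≤ (8 * (Z : ℝ) ^ 4) * (R : ℝ) ^ (12 : ℕ) := by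
              calc _ ≤ 8 * (R : ℝ) ^ 12 * (Z : ℝ) ^ 4 := h3
                _ = (8 * (Z : ℝ) ^ 4) * (R : ℝ) ^ (12 : ℕ) := by ring
            exact le_of_mul_le_mul_right h4' hx12
          linarith
        -- pass to the exponent `η'/4`
        have hZη' : ((R : ℝ) / 8) ^ (η' / 4) ≤ (Z : ℝ) ^ η' := by
          have h1 : ((R : ℝ) / 8) ^ (η' / 4) ≤ ((Z : ℝ) ^ 4) ^ (η' / 4) :=
            Real.rpow_le_rpow (by positivity) hZ4 (by positivity)
          have h2 : ((Z : ℝ) ^ 4) ^ (η' / 4) = (Z : ℝ) ^ η' := by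
            rw [← Real.rpow_natCast, ← Real.rpow_mul hZ0]
            congr 1
            push_cast
            ring
          rw [← h2]; exact h1
        have hsplitR : ((R : ℝ) / 8) ^ (η' / 4) = (R : ℝ) ^ (η' / 8) * (R : ℝ) ^ (η' / 8) / (8 : ℝ) ^ (η' / 4) := by
          rw [Real.div_rpow hx0.le (by norm_num), ← Real.rpow_add hx0]; ring_nf
        have h8δ : 8 * δ = η' / 8 := by rw [hδ]; ring
        have hkey : (R : ℝ) ^ (η' / 8) * (R : ℝ) ^ (η' / 8) < K * (R : ℝ) ^ (η' / 8) := by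
          have h88 : (0 : ℝ) < (8 : ℝ) ^ (η' / 4) := by positivity
          have h1 : (R : ℝ) ^ (η' / 8) * (R : ℝ) ^ (η' / 8) / (8 : ℝ) ^ (η' / 4) < 16 * (R : ℝ) ^ (η' / 8) := by
            calc _ = ((R : ℝ) / 8) ^ (η' / 4) := hsplitR.symm
              _ ≤ (Z : ℝ) ^ η' := hZη'
              _ < ((a * u * v : ℕ) : ℝ) := hA
              _ ≤ 16 * (R : ℝ) ^ (8 * δ) := hauv
              _ = 16 * (R : ℝ) ^ (η' / 8) := by rw [h8δ]
          rw [div_lt_iff₀ h88] at h1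
          calc _ < 16 * (R : ℝ) ^ (η' / 8) * (8 : ℝ) ^ (η' / 4) := h1
            _ = K * (R : ℝ) ^ (η' / 8) := by rw [hK]; ring
        have hRη : (R : ℝ) ^ (η' / 8) < K :=
          lt_of_mul_lt_mul_right hkey (Real.rpow_nonneg hx0.le _)
        have hRK : (R : ℝ) < K ^ (8 / η') := by
          have h1 : ((R : ℝ) ^ (η' / 8)) ^ (8 / η') < K ^ (8 / η') :=
            Real.rpow_lt_rpow (Real.rpow_nonneg hx0.le _) hRη (by positivity)
          have h2 : ((R : ℝ) ^ (η' / 8)) ^ (8 / η') = (R : ℝ) := by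
            rw [← Real.rpow_mul hx0.le]
            have : η' / 8 * (8 / η') = 1 := by field_simp
            rw [this, Real.rpow_one]
          rw [h2] at h1; exact h1
        calc (R : ℝ) < K ^ (8 / η') := hRK
          _ ≤ max (8 * (B : ℝ) ^ 4) (K ^ (8 / η')) := le_max_right _ _
          _ < R₀ := by rw [hR₀]; linarith
    -- conclude on the exceptional triple
    have hR₀sq : (R : ℝ) ^ 2 < R₀ ^ 2 := by
      have : (0 : ℝ) ≤ (R : ℝ) := hx0.le
      nlinarith
    calc (c : ℝ) < 2 * (R : ℝ) ^ 2 := hc2R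
      _ ≤ 2 * R₀ ^ 2 + 1 := by linarith
      _ = (2 * R₀ ^ 2 + 1) * 1 := (mul_one _).symm
      _ ≤ (2 * R₀ ^ 2 + 1) * (R : ℝ) ^ (2 - δ) := by
          apply mul_le_mul_of_nonneg_left hpow1; positivity
  · -- ordinary triple: `c < R^(2−δ) ≤ C·R^(2−δ)`
    push Not at hexc
    calc (c : ℝ) < (R : ℝ) ^ (2 - δ) := hexc
      _ = 1 * (R : ℝ) ^ (2 - δ) := (one_mul _).symm
      _ ≤ (2 * R₀ ^ 2 + 1) * (R : ℝ) ^ (2 - δ) := by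
          apply mul_le_mul_of_nonneg_right _ (by positivity)
          nlinarith [sq_nonneg R₀]

end Summit.ABC.ABC.Theorems.DepthCountedABC
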